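import Summits.Langlands.Langlands.Theses.OrdinaryLocusCarving

/-!
# Route OrdinaryLocusCarving — Assembly

The assembly item (stmt-Langlands-27762) of the child route `OrdinaryLocusCarving` (decomp-langlands lens-6 gen 24; `--refines route-Langlands-ParahoricFibre:ParahoricOccurrence`, edge split, depth 1 — the D-0179 blocker crux OCC 18194 of the LIVE route ParahoricFibre) for
OCC = `ParahoricFibre.ParahoricOccurrence` (stmt-Langlands-18194):
`OrdinaryParahoricOccurrence → NonOrdinaryParahoricOccurrence → ParahoricFibre.ParahoricOccurrence`.

This is literally the type of the route file's sorry-free deciding theorem `Summit.Langlands.Langlands.Theses.OrdinaryLocusCarving.closes`.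
Nothing here proves `Langlands` (nor the parent piece): the assembly records only that the two cell items of the route (ORD, NONORD), taken together,
imply the parent piece by name.
-/

set_option linter.dupNamespace false -- project-wide option (lakefile weak.linter.dupNamespace); `Summit.Langlands.Langlands` is the mandated namespace

namespace Summit.Langlands.Langlands.Theorems

/-- **Assembly of route OrdinaryLocusCarving** (stmt-Langlands-27762): `OrdinaryParahoricOccurrence → NonOrdinaryParahoricOccurrence → ParahoricFibre.ParahoricOccurrence`.
Proof: unfold `Assembly` and apply the route's deciding theorem `Theses.OrdinaryLocusCarving.closes`. -/
theorem ordinaryLocusCarving_assembly_proof :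
    Summit.Langlands.Langlands.Theses.OrdinaryLocusCarving.Assembly := by
  unfold Summit.Langlands.Langlands.Theses.OrdinaryLocusCarving.Assembly
  exact Summit.Langlands.Langlands.Theses.OrdinaryLocusCarving.closes

end Summit.Langlands.Langlands.Theorems
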